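import Mathlib
import HarnessLib
import Summits.AtomisticToContinuum.FouriersLaw.Theses.JunctionLocality
import Summits.AtomisticToContinuum.FouriersLaw.Theorems.JunctionLocalitySuperadditiveResistanceStubInsertionIdentity
import Summits.AtomisticToContinuum.FouriersLaw.Theorems.JunctionLocalitySuperadditiveResistanceKuboResolvent

/-!
# The uniform resolvent bound `κ² ‖g_κ‖² ≤ 2T²` for the γ-probed device
(helper `helper_resolventUniformBound` toward stub `stub_kuboFrame`, line `thermalise-then-cut-probe-insertion`,
crux stmt-AtomisticToContinuum-11748, skeleton v3.1)

Helper file (`--supports` stmt-AtomisticToContinuum-11748). The device is the `(N+M)`-chain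
`pinnedChain ω₂ lam β γ` with two extra friction-`γ` Langevin thermostats on the junction momenta `p_{N−1}, p_N`,
all terminals at temperature `T`; `L_dev = deviceGenerator … (fun _ => T) = X_H + γ S_B` (`B = deviceWeight N M`,
landed `deviceGenerator_eq`). For every `κ > 0` the κ-RESOLVENT FIELD `g_κ ∈ C² ∩ L²(μ_T)` of the terminal observable
`k = p_s² − T`, i.e. `κ g_κ − L_dev g_κ = k` pointwise, exists unconditionally (landed `exists_deviceResolventField`).
This file proves the bound that is uniform in `κ`:

  `κ² ∫ g_κ² dμ_T ≤ 2 T² = ‖p_s² − T‖²_{L²(μ_T)}`.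

Proof: the landed fluctuation–dissipation identity with a mass term (`Kubo.resolvent_fd`):
`∫ g k ρ = κ ∫ g² ρ + γ T Σ_i B_i ∫ (∂_{p_i} g)² ρ ≥ κ ∫ g² ρ` (`ρ = e^{−H/T}`), the pointwise AM–GM bound
`g k ≤ (κ/2) g² + k²/(2κ)`, and the Gaussian fourth moment `∫ (p_s² − T)² ρ = 2T² ∫ ρ` (landed `Kubo.gauss_ibp` with
`F = p_s² − T`, `∂_{p_s} F = 2 p_s`, `∫ p_s² ρ = T ∫ ρ`). No definitions; standard axioms.
References: folklore (dissipativity of `X_H + γ S_B` in `L²(e^{−H/T})`, Stein's identity).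
-/

noncomputable section

open MeasureTheory Filter Topology ProbabilityTheory
open scoped ContDiff NNReal
open Literature.MathematicalPhysics.KineticTheory.HeatConduction

namespace Summit.AtomisticToContinuum.FouriersLaw.Cruxes.SuperadditiveResistance.ThermaliseThenCutProbeInsertion

open Summit.AtomisticToContinuum.FouriersLaw.Theorems.SuperadditiveResistance
open Summit.AtomisticToContinuum.FouriersLaw.Theorems.SuperadditiveResistance.Kubo
  (resolvent_fd gauss_ibp memLp_kinetic memLp_momentum integral_sq_mul_gibbsDensity_eq
    integrable_mul_mul_gibbsDensity integrable_sq_mul_gibbsDensity)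
open Summit.AtomisticToContinuum.FouriersLaw.Theorems.SuperadditiveResistance.DeviceLiouville
  (liouvilleOp bathOp deviceWeight deviceGenerator_eq kin_eq_sq)

section FourthMoment

variable {ω₂ lam β γ : ℝ}

/-- `∂_{p_i}(p_i² − T) = 2 p_i`. -/
theorem partialP_kinetic {L : ℕ} (T : ℝ) (i : Fin L) (x : PhaseSpace L) :
    partialP i (fun y : PhaseSpace L => y.2 i ^ 2 - T) x = 2 * x.2 i := by
  simp only [partialP, Function.update_self]
  have h : HasDerivAt (fun t : ℝ => t ^ 2 - T) (2 * x.2 i) (x.2 i) := by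
    simpa using ((hasDerivAt_id (x.2 i)).pow 2).sub_const T
  exact h.deriv

/-- **Gaussian fourth moment**: `∫ (p_i² − T)² e^{−H/T} = 2T² ∫ e^{−H/T}` (pinned chain, `T > 0`). -/
theorem integral_kinetic_sq_mul_gibbsDensity (hω : 0 < ω₂) (hl : 0 ≤ lam) (hβ : 0 ≤ β) (L : ℕ) {T : ℝ}
    (hT : 0 < T) (i : Fin L) :
    ∫ x, (x.2 i ^ 2 - T) ^ 2 * (pinnedChain ω₂ lam β γ).gibbsDensity L T x =
      2 * T ^ 2 * ∫ x, (pinnedChain ω₂ lam β γ).gibbsDensity L T x := by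
  have hF : ContDiff ℝ 1 (fun y : PhaseSpace L => y.2 i ^ 2 - T) := by fun_prop
  have hdF : partialP i (fun y : PhaseSpace L => y.2 i ^ 2 - T) = fun x => 2 * x.2 i :=
    funext fun x => partialP_kinetic T i x
  have h := gauss_ibp (γ := γ) hω hl hβ L hT i hF (memLp_kinetic hω hl hβ L hT i)
    (by rw [hdF]; exact (memLp_momentum hω hl hβ L hT i).const_mul 2)
  rw [hdF] at h
  have e1 : (fun x : PhaseSpace L => (x.2 i ^ 2 - T) ^ 2 * (pinnedChain ω₂ lam β γ).gibbsDensity L T x) =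
      fun x => (x.2 i ^ 2 - T) * (x.2 i ^ 2 - T) * (pinnedChain ω₂ lam β γ).gibbsDensity L T x := by
    funext x; ring
  have e2 : (fun x : PhaseSpace L => x.2 i * (2 * x.2 i) * (pinnedChain ω₂ lam β γ).gibbsDensity L T x) =
      fun x => 2 * (x.2 i ^ 2 * (pinnedChain ω₂ lam β γ).gibbsDensity L T x) := by
    funext x; ring
  rw [e1, h, e2, integral_const_mul, integral_sq_mul_gibbsDensity_eq (γ := γ) hω hl hβ L hT i]
  ring

end FourthMoment

section Bound

variable {ω₂ lam β γ : ℝ}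

/-- **Dissipative resolvent bound, Lebesgue form.** For a `σ`-resolvent pair `σ X_H g + c S_B g = −(k − κ g)`
(`B ≥ 0`, `c > 0`, `κ > 0`, `g ∈ C² ∩ L²(μ_T)`, `k ∈ L²(μ_T)`): `κ² ∫ g² ρ ≤ ∫ k² ρ`. -/
theorem resolvent_sq_bound (hω : 0 < ω₂) (hl : 0 ≤ lam) (hβ : 0 ≤ β) (L : ℕ) {T : ℝ} (hT : 0 < T)
    (B : Fin L → ℝ) (hB : ∀ i, 0 ≤ B i) (σ : ℝ) {c : ℝ} (hc : 0 < c) {κ : ℝ} (hκ : 0 < κ)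
    {g k : PhaseSpace L → ℝ} (hg : ContDiff ℝ 2 g)
    (hg2 : MemLp g 2 ((pinnedChain ω₂ lam β γ).gibbsMeasure L T))
    (hk2 : MemLp k 2 ((pinnedChain ω₂ lam β γ).gibbsMeasure L T))
    (hpde : ∀ x, σ * liouvilleOp (pinnedChain ω₂ lam β γ) L g x + c * bathOp L B T g x = -(k x - κ * g x)) :
    κ ^ 2 * ∫ x, g x ^ 2 * (pinnedChain ω₂ lam β γ).gibbsDensity L T x ≤
      ∫ x, k x ^ 2 * (pinnedChain ω₂ lam β γ).gibbsDensity L T x := by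
  have hfd := resolvent_fd hω hl hβ L hT B hB σ hc κ hg hg2 hk2 hpde
  have hρ : ∀ x, 0 ≤ (pinnedChain ω₂ lam β γ).gibbsDensity L T x := fun x =>
    ((pinnedChain ω₂ lam β γ).gibbsDensity_pos L T x).le
  -- the carré du champ is non-negative
  have hD : 0 ≤ c * T * ∑ i, B i * ∫ x, partialP i g x ^ 2 * (pinnedChain ω₂ lam β γ).gibbsDensity L T x := by
    refine mul_nonneg (mul_nonneg hc.le hT.le) (Finset.sum_nonneg fun i _ => mul_nonneg (hB i) ?_)
    exact integral_nonneg fun x => mul_nonneg (sq_nonneg _) (hρ x)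
  -- AM–GM: g k ≤ (κ/2) g² + k²/(2κ)
  have hI1 := integrable_mul_mul_gibbsDensity hω hl hβ γ L hT hg2 hk2
  have hI2 := integrable_sq_mul_gibbsDensity hω hl hβ γ L hT hg2
  have hI3 := integrable_sq_mul_gibbsDensity hω hl hβ γ L hT hk2
  have hamgm : ∫ x, g x * k x * (pinnedChain ω₂ lam β γ).gibbsDensity L T x ≤
      ∫ x, (κ / 2 * (g x ^ 2 * (pinnedChain ω₂ lam β γ).gibbsDensity L T x) +
        1 / (2 * κ) * (k x ^ 2 * (pinnedChain ω₂ lam β γ).gibbsDensity L T x)) := by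
    refine integral_mono hI1 ((hI2.const_mul _).add (hI3.const_mul _)) fun x => ?_
    have hρx := hρ x
    have key : g x * k x ≤ κ / 2 * g x ^ 2 + 1 / (2 * κ) * k x ^ 2 := by
      have h1 : 0 ≤ (κ * g x - k x) ^ 2 := sq_nonneg _
      have h2 : κ / 2 * g x ^ 2 + 1 / (2 * κ) * k x ^ 2 - g x * k x = (κ * g x - k x) ^ 2 / (2 * κ) := by
        field_simp
        ring
      have h3 : 0 ≤ (κ * g x - k x) ^ 2 / (2 * κ) := div_nonneg h1 (by positivity)
      linarith
    have := mul_le_mul_of_nonneg_right key hρx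
    calc g x * k x * (pinnedChain ω₂ lam β γ).gibbsDensity L T x
        ≤ (κ / 2 * g x ^ 2 + 1 / (2 * κ) * k x ^ 2) * (pinnedChain ω₂ lam β γ).gibbsDensity L T x := this
      _ = _ := by ring
  rw [integral_add (hI2.const_mul _) (hI3.const_mul _), integral_const_mul, integral_const_mul] at hamgm
  -- combine: κ A ≤ A' := ∫ g k ρ ≤ (κ/2) A + (1/(2κ)) C  ⇒  κ² A ≤ C
  set A := ∫ x, g x ^ 2 * (pinnedChain ω₂ lam β γ).gibbsDensity L T x with hA
  set C := ∫ x, k x ^ 2 * (pinnedChain ω₂ lam β γ).gibbsDensity L T x with hC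
  have h1 : κ * A ≤ κ / 2 * A + 1 / (2 * κ) * C := by linarith
  have h2 : κ / 2 * A ≤ 1 / (2 * κ) * C := by linarith
  have h3 := mul_le_mul_of_nonneg_left h2 (show (0 : ℝ) ≤ 2 * κ by positivity)
  have e1 : 2 * κ * (κ / 2 * A) = κ ^ 2 * A := by ring
  have e2 : 2 * κ * (1 / (2 * κ) * C) = C := by field_simp
  linarith [e1, e2]

/-- **HELPER (B) — the uniform resolvent bound `κ² ‖g_κ‖² ≤ ‖p_s² − T‖² = 2T²`** (registered helper of stub
`stub_kuboFrame`, line `thermalise-then-cut-probe-insertion`). For the γ-probed device of `pinnedChain ω₂ lam β γ`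
at temperature `T`, `N, M ≥ 2`, a site `s < N + M`, `κ > 0` and any `g ∈ C² ∩ L²(μ_T)` with
`κ g − L_dev g = p_s² − T` pointwise: `κ² ∫ g² dμ_T ≤ 2T²`. (Dissipativity of `L_dev` on `C² ∩ L²(μ_T)` via the
landed `resolvent_fd`, AM–GM, and the Gaussian fourth moment.) -/
theorem helper_resolventUniformBound :
    ∀ (ω₂ lam β γ T : ℝ), 0 < ω₂ → 0 < lam → 0 < β → 0 < γ → 0 < T →
      ∀ (N M : ℕ), 2 ≤ N → 2 ≤ M → ∀ (s : ℕ), s < N + M →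
      ∀ (κ : ℝ), 0 < κ → ∀ (g : PhaseSpace (N + M) → ℝ), ContDiff ℝ 2 g →
        MemLp g 2 ((pinnedChain ω₂ lam β γ).gibbsMeasure (N + M) T) →
        (∀ x, κ * g x - deviceGenerator (pinnedChain ω₂ lam β γ) N M (fun _ => T) g x = kin (N + M) s x - T) →
        κ ^ 2 * ∫ x, g x ^ 2 ∂((pinnedChain ω₂ lam β γ).gibbsMeasure (N + M) T) ≤ 2 * T ^ 2 := by
  intro ω₂ lam β γ T hω hl hβ hγ hT N M hN hM s hs κ hκ g hgC hgL hpde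
  -- the source `k = p_s² − T`
  have hk2 : MemLp (fun y : PhaseSpace (N + M) => y.2 ⟨s, hs⟩ ^ 2 - T) 2
      ((pinnedChain ω₂ lam β γ).gibbsMeasure (N + M) T) := memLp_kinetic hω hl.le hβ.le (N + M) hT ⟨s, hs⟩
  -- the equation in pair form: `X_H g + γ S_B g = −(k − κ g)`, `B = deviceWeight`
  have hpde' : ∀ x, 1 * liouvilleOp (pinnedChain ω₂ lam β γ) (N + M) g x +
      γ * bathOp (N + M) (deviceWeight N M) T g x = -((x.2 ⟨s, hs⟩ ^ 2 - T) - κ * g x) := by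
    intro x
    have e := hpde x
    rw [show deviceGenerator (pinnedChain ω₂ lam β γ) N M (fun _ => T) g x =
        DeviceLiouville.deviceGenerator (pinnedChain ω₂ lam β γ) N M (fun _ => T) g x from rfl,
      deviceGenerator_eq,
      show kin (N + M) s x = DeviceLiouville.kin (N + M) s x from rfl, kin_eq_sq hs] at e
    have hPγ : (pinnedChain ω₂ lam β γ).γ = γ := rfl
    rw [hPγ] at e
    linarith
  have hB : ∀ i, 0 ≤ deviceWeight N M i := fun i => by
    unfold DeviceLiouville.deviceWeight OscillatorChain.bathWeight
    split_ifs <;> norm_num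
  -- Lebesgue form of the bound and the fourth moment
  have hleb := resolvent_sq_bound hω hl.le hβ.le (N + M) hT (deviceWeight N M) hB 1 hγ hκ hgC hgL hk2 hpde'
  rw [integral_kinetic_sq_mul_gibbsDensity (γ := γ) hω hl.le hβ.le (N + M) hT ⟨s, hs⟩] at hleb
  -- normalise by the partition function
  have hZ : 0 < ∫ x, (pinnedChain ω₂ lam β γ).gibbsDensity (N + M) T x :=
    integral_exp_pos (pinnedChain_integrable_gibbsDensity hω hl.le hβ.le γ (N + M) hT)
  rw [(pinnedChain ω₂ lam β γ).integral_gibbsMeasure]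
  rw [show κ ^ 2 * ((∫ x, (pinnedChain ω₂ lam β γ).gibbsDensity (N + M) T x)⁻¹ *
      ∫ x, g x ^ 2 * (pinnedChain ω₂ lam β γ).gibbsDensity (N + M) T x) =
      (∫ x, (pinnedChain ω₂ lam β γ).gibbsDensity (N + M) T x)⁻¹ *
        (κ ^ 2 * ∫ x, g x ^ 2 * (pinnedChain ω₂ lam β γ).gibbsDensity (N + M) T x) by ring,
    inv_mul_le_iff₀ hZ]
  linarith
end Bound

end Summit.AtomisticToContinuum.FouriersLaw.Cruxes.SuperadditiveResistance.ThermaliseThenCutProbeInsertion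

end
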